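import Mathlib.RingTheory.Ideal.Quotient.Operations
import Mathlib.RingTheory.Ideal.Maximal
import Mathlib.Order.Filter.Ultrafilter.Basic
import Mathlib.RingTheory.Derivation.Basic
import Mathlib.Algebra.Algebra.Pi
import Mathlib.Algebra.MvPolynomial.Eval
import Mathlib.Algebra.CharP.Basic
import HarnessLib

/-!
# Weak CIT, step 2: ultraproducts of fields with derivations

Support file for the discharge of `Literature.NumberTheory.Transcendental.weakCIT`
(`IntersectionsWithTori.lean`). The finiteness in weak CIT comes, in Zilber 2002 (Thm 2 ⟹ Cor. 3)
and Kirby 2009 (Thm 4.3, "uniform Schanuel property"), from the compactness theorem of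
first-order logic applied to Ax's theorem in all differential fields. We run the compactness
argument with an explicit ultraproduct, which this file constructs by hand (Mathlib's
`Filter.Germ` needs a constant family of types, and `FirstOrder.Language.Ultraproduct` would force
a detour through `Language.ring`):

* `nullIdeal F U` — for a family of fields `F k` and an ultrafilter `U`, the ideal of
  `U`-almost-everywhere-zero sequences in `Π k, F k`; it is maximal (`nullIdeal_isMaximal`), so
* `Ultraproduct F U = (Π k, F k) ⧸ nullIdeal F U` is a field (Łoś for the field axioms, via
  `Ideal.Quotient.field`), with the Łoś mini-lemmas `mk_eq_mk_iff`, `mk_eq_zero_iff`,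
  `mk_ne_zero_iff`, `mk_inv`, `mk_zpow`, `prod_mk_zpow`, `aeval_mk`, and `CharZero`;
* `liftDerivation D` — the componentwise derivation `[f] ↦ [k ↦ D_k (f k)]` of the ultraproduct
  induced by derivations `D_k` of the factors (`liftDerivation_mk`), and the Łoś lemma for
  "killed by finitely many derivations" (`forall_liftDerivation_mk_eq_zero_iff`).

Everything here is folklore model theory (Łoś's theorem for atomic formulas).

## References

* J. Kirby, *The theory of the exponential differential equations of semiabelian varieties*,
  Selecta Math. 15 (2009) 445–486, §4.1 (compactness ⟹ uniform Schanuel property).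
* C. C. Chang, H. J. Keisler, *Model Theory*, 3rd ed., North-Holland 1990, §4.1 (ultraproducts,
  Łoś's theorem).
-/

noncomputable section

open Filter MvPolynomial

namespace Literature.NumberTheory.Transcendental.WeakCIT

universe u v

variable {ι : Type u} (F : ι → Type v) [∀ k, Field (F k)] (U : Ultrafilter ι)

/-- The ideal of `U`-null sequences `{f | f k = 0 for U-almost all k}` of the product ring
`Π k, F k`. [folklore] -/
def nullIdeal : Ideal (∀ k, F k) where
  carrier := {f | ∀ᶠ k in (U : Filter ι), f k = 0}
  add_mem' {f g} hf hg := (hf.and hg).mono fun k hk => by simp [hk.1, hk.2]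
  zero_mem' := Eventually.of_forall fun _ => rfl
  smul_mem' c f hf := by
    refine (hf : ∀ᶠ k in (U : Filter ι), f k = 0).mono fun k hk => ?_
    simp [hk]

variable {F U} in
/-- Membership in the null ideal. [folklore] -/
theorem mem_nullIdeal_iff {f : ∀ k, F k} :
    f ∈ nullIdeal F U ↔ ∀ᶠ k in (U : Filter ι), f k = 0 :=
  Iff.rfl

/-- For an ultrafilter the null ideal is maximal: a non-null sequence is invertible modulo null
sequences (Łoś for `∃ y, x y = 1`). [folklore] -/
theorem nullIdeal_isMaximal : (nullIdeal F U).IsMaximal := by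
  classical
  rw [Ideal.isMaximal_iff]
  refine ⟨fun h => ?_, fun J f hIJ hf hfJ => ?_⟩
  · have h' : ∀ᶠ k in (U : Filter ι), False :=
      (h : ∀ᶠ k in (U : Filter ι), (1 : ∀ k, F k) k = 0).mono fun k hk => one_ne_zero hk
    exact U.neBot.ne (Filter.eventually_false_iff_eq_bot.mp h')
  · have hne : ∀ᶠ k in (U : Filter ι), f k ≠ 0 := U.eventually_not.mpr hf
    let g : ∀ k, F k := fun k => (f k)⁻¹
    have h1 : 1 - g * f ∈ nullIdeal F U := hne.mono fun k hk => by
      simp [g, inv_mul_cancel₀ hk]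
    have : (1 : ∀ k, F k) = (1 - g * f) + g * f := by ring
    rw [this]
    exact J.add_mem (hIJ h1) (J.mul_mem_left g hfJ)

/-- The null ideal is maximal (instance form, feeding `Ideal.Quotient.field`). [folklore] -/
instance nullIdeal.isMaximal : (nullIdeal F U).IsMaximal := nullIdeal_isMaximal F U

/-- The ultraproduct `Π_U F k = (Π k, F k) ⧸ nullIdeal F U` of the fields `F k`. [folklore] -/
abbrev Ultraproduct : Type (max u v) := (∀ k, F k) ⧸ nullIdeal F U

/-- The ultraproduct of fields is a field (Łoś). [folklore] -/
instance Ultraproduct.instField : Field (Ultraproduct F U) := Ideal.Quotient.field (nullIdeal F U)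

/-- The class map `Π k, F k → Π_U F k`. [folklore] -/
abbrev mk : (∀ k, F k) →+* Ultraproduct F U := Ideal.Quotient.mk (nullIdeal F U)

variable {F U}

/-- Łoś for equality: two sequences have the same class iff they agree `U`-almost everywhere.
[folklore] -/
theorem mk_eq_mk_iff {f g : ∀ k, F k} :
    mk F U f = mk F U g ↔ ∀ᶠ k in (U : Filter ι), f k = g k := by
  rw [Ideal.Quotient.eq, mem_nullIdeal_iff]
  simp only [Pi.sub_apply, sub_eq_zero]

/-- Łoś for `= 0`. [folklore] -/
theorem mk_eq_zero_iff {f : ∀ k, F k} : mk F U f = 0 ↔ ∀ᶠ k in (U : Filter ι), f k = 0 :=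
  Ideal.Quotient.eq_zero_iff_mem.trans mem_nullIdeal_iff

/-- Łoś for `≠ 0`. [folklore] -/
theorem mk_ne_zero_iff {f : ∀ k, F k} : mk F U f ≠ 0 ↔ ∀ᶠ k in (U : Filter ι), f k ≠ 0 := by
  rw [Ne, mk_eq_zero_iff, U.eventually_not]

/-- Every element of the ultraproduct is the class of a sequence. [folklore] -/
theorem mk_surjective : Function.Surjective (mk F U) :=
  Ideal.Quotient.mk_surjective

/-- The class map commutes with (componentwise vs field) inversion. [folklore] -/
theorem mk_inv (f : ∀ k, F k) : mk F U f⁻¹ = (mk F U f)⁻¹ := by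
  classical
  by_cases hf : mk F U f = 0
  · rw [hf, inv_zero, mk_eq_zero_iff]
    exact (mk_eq_zero_iff.mp hf).mono fun k hk => by simp [hk]
  · symm
    apply inv_eq_of_mul_eq_one_right
    rw [← map_mul, ← (mk F U).map_one, mk_eq_mk_iff]
    exact (mk_ne_zero_iff.mp hf).mono fun k hk => by simp [mul_inv_cancel₀ hk]

/-- The class map commutes with integer powers. [folklore] -/
theorem mk_zpow (f : ∀ k, F k) (z : ℤ) : mk F U (f ^ z) = mk F U f ^ z := by
  cases z with
  | ofNat m => simp
  | negSucc m => rw [zpow_negSucc, zpow_negSucc, mk_inv, map_pow]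

/-- Łoś for Laurent monomials: `∏ᵢ [yᵢ] ^ qᵢ = [k ↦ ∏ᵢ yᵢ(k) ^ qᵢ]`. [folklore] -/
theorem prod_mk_zpow {n : ℕ} (y : ∀ k, Fin n → F k) (q : Fin n → ℤ) :
    ∏ i, mk F U (fun k => y k i) ^ q i = mk F U (fun k => ∏ i, y k i ^ q i) := by
  have : (fun k => ∏ i, y k i ^ q i) = ∏ i, (fun k => y k i) ^ q i := by
    funext k
    simp [Finset.prod_apply]
  rw [this, map_prod]
  exact Finset.prod_congr rfl fun i _ => (mk_zpow _ _).symm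

/-- Łoś for sums of products: `∑ₗ [aₗ] [bₗ] = [k ↦ ∑ₗ aₗ(k) bₗ(k)]`. [folklore] -/
theorem sum_mk_mul_mk {m : ℕ} (a b : ∀ k, Fin m → F k) :
    ∑ l, mk F U (fun k => a k l) * mk F U (fun k => b k l) =
      mk F U (fun k => ∑ l, a k l * b k l) := by
  have : (fun k => ∑ l, a k l * b k l) = ∑ l, (fun k => a k l) * (fun k => b k l) := by
    funext k
    simp [Finset.sum_apply]
  rw [this, map_sum]
  simp only [map_mul]

section Algebra

variable {R : Type*} [CommSemiring R] [∀ k, Algebra R (F k)]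

/-- The structure map of the ultraproduct as an `R`-algebra is componentwise. [folklore] -/
theorem algebraMap_eq_mk (c : R) :
    algebraMap R (Ultraproduct F U) c = mk F U (fun k => algebraMap R (F k) c) :=
  rfl

/-- Łoś for polynomial identities: evaluating a polynomial at classes of sequences gives the class
of the componentwise evaluations. [folklore] -/
theorem aeval_mk {σ : Type*} (y : ∀ k, σ → F k) (p : MvPolynomial σ R) :
    aeval (fun i => mk F U (fun k => y k i)) p = mk F U (fun k => aeval (y k) p) := by
  have h1 : (aeval (fun i => mk F U (fun k => y k i)) : MvPolynomial σ R →ₐ[R] Ultraproduct F U) =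
      (Ideal.Quotient.mkₐ R (nullIdeal F U)).comp (aeval (fun i k => y k i)) := by
    rw [MvPolynomial.comp_aeval]
    rfl
  have h2 : ∀ k, (Pi.evalAlgHom R F k).comp (aeval (fun i k => y k i)) = aeval (y k) := fun k => by
    rw [MvPolynomial.comp_aeval]
    rfl
  rw [h1, AlgHom.comp_apply, Ideal.Quotient.mkₐ_eq_mk]
  congr 1
  funext k
  exact congrArg (fun φ : MvPolynomial σ R →ₐ[R] F k => φ p) (h2 k)

end Algebra

/-- The ultraproduct of fields of characteristic zero has characteristic zero (Łoś for `m ≠ 0`).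
[folklore] -/
instance Ultraproduct.charZero [∀ k, CharZero (F k)] : CharZero (Ultraproduct F U) := by
  refine charZero_of_inj_zero fun m hm => ?_
  by_contra hm0
  have h : (m : Ultraproduct F U) = mk F U (fun k => (m : F k)) := by
    rw [← map_natCast (mk F U) m]
    rfl
  rw [h, mk_eq_zero_iff] at hm
  have h' : ∀ᶠ k in (U : Filter ι), False := hm.mono fun k hk => hm0 (Nat.cast_eq_zero.mp hk)
  exact U.neBot.ne (Filter.eventually_false_iff_eq_bot.mp h')

/-! ### Componentwise derivations -/

/-- The componentwise map `f ↦ (k ↦ D_k (f k))` descends to the ultraproduct. [folklore] -/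
def liftFun (D : ∀ k, Derivation ℤ (F k) (F k)) : Ultraproduct F U → Ultraproduct F U :=
  Quotient.map' (fun f k => D k (f k)) fun f g hfg => by
    rw [Submodule.quotientRel_def, mem_nullIdeal_iff] at hfg ⊢
    exact hfg.mono fun k hk => by
      have : f k = g k := sub_eq_zero.mp (by simpa using hk)
      simp [this]

/-- Computation rule for `liftFun` on classes. [folklore] -/
theorem liftFun_mk (D : ∀ k, Derivation ℤ (F k) (F k)) (f : ∀ k, F k) :
    liftFun D (mk F U f) = mk F U (fun k => D k (f k)) :=
  rfl

/-- The componentwise map `[f] ↦ [k ↦ D_k (f k)]` as an additive homomorphism. [folklore] -/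
def liftAddHom (D : ∀ k, Derivation ℤ (F k) (F k)) : Ultraproduct F U →+ Ultraproduct F U where
  toFun := liftFun D
  map_zero' := by
    have h : liftFun D (mk F U 0) = 0 := by
      rw [liftFun_mk, mk_eq_zero_iff]
      exact Eventually.of_forall fun k => by simp
    rwa [map_zero] at h
  map_add' a b := by
    obtain ⟨f, rfl⟩ := mk_surjective a
    obtain ⟨g, rfl⟩ := mk_surjective b
    rw [← map_add, liftFun_mk, liftFun_mk, liftFun_mk, ← map_add]
    congr 1
    funext k
    simp

/-- **The ultraproduct of derivations**: the componentwise derivation `[f] ↦ [k ↦ D_k (f k)]` of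
`Π_U F k`. [folklore] -/
def liftDerivation (D : ∀ k, Derivation ℤ (F k) (F k)) :
    Derivation ℤ (Ultraproduct F U) (Ultraproduct F U) where
  __ := (liftAddHom D).toIntLinearMap
  map_one_eq_zero' := by
    show liftFun D (mk F U 1) = 0
    rw [liftFun_mk, mk_eq_zero_iff]
    exact Eventually.of_forall fun k => by simp
  leibniz' a b := by
    obtain ⟨f, rfl⟩ := mk_surjective a
    obtain ⟨g, rfl⟩ := mk_surjective b
    show liftFun D (mk F U f * mk F U g) =
      mk F U f • liftFun D (mk F U g) + mk F U g • liftFun D (mk F U f)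
    rw [← map_mul, liftFun_mk, liftFun_mk, liftFun_mk, smul_eq_mul, smul_eq_mul, ← map_mul,
      ← map_mul, ← map_add]
    congr 1
    funext k
    simp [Derivation.leibniz]

/-- Łoś for derivations: `D_U [f] = [k ↦ D_k (f k)]`. [folklore] -/
@[simp] theorem liftDerivation_mk (D : ∀ k, Derivation ℤ (F k) (F k)) (f : ∀ k, F k) :
    liftDerivation D (mk F U f) = mk F U (fun k => D k (f k)) :=
  rfl

/-- Łoś for "killed by the finitely many derivations `D_{k,j}`": `[f]` is a common constant of the
`D_{U,j}` iff `f k` is a common constant of the `D_{k,j}` for `U`-almost all `k`. [folklore] -/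
theorem forall_liftDerivation_mk_eq_zero_iff {m : ℕ} (D : ∀ k, Fin m → Derivation ℤ (F k) (F k))
    (f : ∀ k, F k) :
    (∀ j, liftDerivation (fun k => D k j) (mk F U f) = 0) ↔
      ∀ᶠ k in (U : Filter ι), ∀ j, D k j (f k) = 0 := by
  simp only [liftDerivation_mk, mk_eq_zero_iff]
  exact eventually_all.symm

end Literature.NumberTheory.Transcendental.WeakCIT
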